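import Literature.NumberTheory.NumberFields.HilbertClassFieldArtinEquivariance
import Literature.NumberTheory.NumberFields.CMFieldRelativeClassNumberDivisibility
import Literature.NumberTheory.NumberFields.ClassGroupNormRange
import Literature.NumberTheory.NumberFields.HilbertClassFieldOfGaloisExtension
import Literature.NumberTheory.NumberFields.HilbertClassFieldCorrespondence
import Literature.NumberTheory.NumberFields.CMFieldCompositum
import HarnessLib

/-!
# Inclusion of CM fields: Okazaki's Prop. 27, and `h⁻_K ∣ 2^s h⁻_L` for EVERY pair of CM fields `K ⊆ L`
# (Okazaki, *Acta Arith.* 92 (2000), §5 Prop. 27 and §4 Lemma 24)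

Topic `NumberTheory/NumberFields` (class field theory); namespace `Literature.NumberTheory.NumberFields`.
Theorem-only file (no definition, no named fact, no `sorry`), unconditional.  Sequel of
`CMFieldRelativeClassNumberDivisibility.lean` (the same divisibilities under the hypothesis that
`N_{L/K} : Cl_L → Cl_K` is onto) which REMOVES that hypothesis by class field theory, following Okazaki:
the inputs are the Hilbert class field `H = hilbertClassField K ⊆ K̄` with its Artin isomorphism
(`HilbertClassFieldArtinIsomorphism.lean`), its Galois property over `K⁺` (`HilbertClassFieldOfGaloisExtension.lean`),
the class fields of subgroups (`HilbertClassFieldCorrespondence.lean`: `galSubgroup`, Cox 5.24), the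
equivariance of the Artin isomorphism under a lift `τ̃` of complex conjugation
(`HilbertClassFieldArtinEquivariance.lean`), the image of the norm map `N_{L/K}(Cl_L) = artinEquiv⁻¹ Gal(H/L ∩ H)`
(`ClassGroupNormRange.lean`) and the CM-field lemmas of `CMFieldCompositum.lean` (a subfield of a CM
field is totally real or CM; complex conjugation is central).

> Okazaki, §5, **Proposition 27.** "Let `k ⊂ K` be two CM-fields.  Then the exponent of
> `coker(N : C_K/ιC_{K⁺} → C_k/ιC_{k⁺})` divides `2`.  *Proof.* Let `C = Im(N : C_K → C_k)ιC_{k⁺}`.  Then,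
> by class field theory, the class field `H` associated with `C` is contained in `K`.  Let `σ` be the
> complex conjugation of `K`.  Then `σ` preserves `C_K` and hence it preserves `Im(N : C_K → C_k)`.  It
> obviously preserves `ιC_{k⁺}`.  Therefore, it preserves `C`.  Noting also that `σ` acts on a field `K`
> which contains `H`, we get an isomorphism `Gal(H/k) ≃ C_k/C` of `σ`-modules by class field theory.  By
> Lemma 12, an intermediate field `H` of `K/k` is a CM-field.  By Lemma 6, the action of `σ` on `Gal(H/k)`
> is trivial and so is the action of `σ` on `C_k/C`.  On the other hand, `σ` acts as inversion on
> `C_k/ιC_{k⁺}` and hence on `C_k/C`.  Since the two descriptions of the action of `σ` on `C_k/C` agree,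
> the exponent of `C_k/C` divides `2`."  §4, **Lemma 24.** "Let `k ⊂ K` be two CM-fields, and `r₁` the
> `2`-rank of `ker(N : C_k → C_{k⁺})`.  Then `h⁻_k ∣ 2^{r₁} h⁻_K`."

Here `K ⊆ L` play Okazaki's `k ⊂ K`.  The proof of Prop. 27 is formalised as printed (§§1–5 below),
with "`H ⊆ K`" in the form: the class field `F_S` of `S = N_{L/K}(Cl_L)·ι(Cl_{K⁺})` embeds into `L`
over `K` (§2, norm limitation), hence is CM (§3); "`σ`-modules" = the equivariance of `artinEquiv` under
a lift `τ̃ ∈ Gal(H/K⁺)` of complex conjugation (§1); "Lemma 6" = `IsCMField.ringHom_complexConj`; and the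
conclusion `c̄ ≡ c (mod S)` is `IsCMField.conj_smul_mul_inv_mem` (§4–§5).  From Prop. 27 we derive
Lemma 24 in the form **`h⁻_K ∣ #(ker N_{K/K⁺})[4] · h⁻_L`** (fourth powers of `ker N_{K/K⁺}` are norms from
`ker N_{L/L⁺}`: `c⁴ = N_{L/K}(d/d̄)` when `c² = N_{L/K}(d)·ι(e)`), which has the same odd part as Okazaki's
`2^{r₁}`; in particular **`h⁻_K` odd ⟹ `h⁻_K ∣ h⁻_L` for every pair of CM fields**, and an imaginary
quadratic field of odd class number inside any CM field `L` has `h_K ∣ h⁻_L`.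
-- TODO(general form): Okazaki's exact `2`-power `2^{r₁}` (`r₁` = `2`-rank) instead of `#A_K[4]`.

## Main results (`K L : Type` CM number fields, `L` a `K`-algebra; `K⁺ = maximalRealSubfield K`,
`H = hilbertClassField K`, complex conjugation acting on `Cl` through `ClassGroup.mulEquiv (AmbiguousClass.intAut (complexConj ·))`)

* `IsCMField.exists_lift_complexConj` — complex conjugation lifts to `τ̃ ∈ Gal(H/K⁺)`.
* `nonempty_algHom_fixedField_galSubgroup` — for `S ⊇ N_{L/K}(Cl_L)`, the class field of `S` embeds
  into `L` over `K` (any number fields `K ⊆ L`).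
* `IsCMField.isCMField_fixedField_galSubgroup` — … and is a CM field (for `K ⊆ L` CM);
  `IsCMField.lift_mem_fixedField_galSubgroup` — it is `τ̃`-stable when `S` is conjugation-stable.
* **`IsCMField.conj_mul_inv_mem_galSubgroup`** — `τ̃ g τ̃⁻¹ g⁻¹ ∈ artinEquiv(S)` for all `g ∈ Gal(H/K)`.
* **`IsCMField.conj_smul_mul_inv_mem`** — `c̄ · c⁻¹ ∈ S`; **`IsCMField.sq_mem_range_sup_range`** —
  Prop. 27: `c² ∈ N_{L/K}(Cl_L) · ι(Cl_{K⁺})` for every class `c` of `K`.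
* `IsCMField.pow_four_mem_map_ker_classGroupNorm` — `c ∈ ker N_{K/K⁺} ⟹ c⁴ ∈ N_{L/K}(ker N_{L/L⁺})`;
  **`IsCMField.card_ker_dvd_card_fourTorsion_mul_card_ker`** — `h⁻_K ∣ #(ker N_{K/K⁺})[4] · h⁻_L`;
  **`IsCMField.classNumber_div_dvd_classNumber_div_of_odd'`** — `h⁻_K` odd ⟹ `h⁻_K ∣ h⁻_L`;
  `IsCMField.classNumber_dvd_classNumber_div_of_finrank_eq_two'` — `[K:ℚ] = 2`, `h_K` odd ⟹ `h_K ∣ h⁻_L`.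

## References

* R. Okazaki, *Inclusion of CM-fields and divisibility of relative class numbers*, Acta Arith. 92 (2000)
  319–338, §2 Lemmas 6, 12, §4 Lemma 24, §5 Prop. 27, Cor. 29 (held `paper:doi-10-4064-aa-92-4-319-338`,
  pp. 4, 7, 11–12, 13–14). [Okazaki2000]
* S. Lang, *Cyclotomic Fields I and II*, GTM 121 (1990), Ch. 3 §4, Lemma (proof). [Lang1990]
* L. C. Washington, *Introduction to Cyclotomic Fields*, 2nd ed. (1997), Thm. 10.1. [Washington1997]
* J. Neukirch, *Algebraic Number Theory* (1999), Ch. VI §6–§7. [NeukirchANT1999]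
-/

noncomputable section

open NumberField NumberField.IsCMField IsDedekindDomain Field
open scoped nonZeroDivisors

namespace Literature.NumberTheory.NumberFields

open Literature.NumberTheory.GaloisRepresentations hilbertClassField

section Setup

variable (K : Type) [Field K] [NumberField K] [IsCMField K]

omit [IsCMField K] in
/-- `K̄ ⊇ H ⊇ K ⊇ K⁺` is a scalar tower. [folklore] -/
private theorem isScalarTower_hcf :
    IsScalarTower (maximalRealSubfield K) K (hilbertClassField K) :=
  IsScalarTower.of_algebraMap_eq fun x => Subtype.ext
    (IsScalarTower.algebraMap_apply (maximalRealSubfield K) K (AlgebraicClosure K) x)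

attribute [local instance] isScalarTower_hcf

/-- `H/K⁺` is Galois (the Hilbert class field of the Galois extension `K/K⁺`). [folklore] -/
private theorem isGalois_hcf : IsGalois (maximalRealSubfield K) (hilbertClassField K) :=
  hilbertClassField.isGalois_of_isGalois (K := maximalRealSubfield K) (L := K)

attribute [local instance] isGalois_hcf

/-- **Complex conjugation lifts to the Hilbert class field**: there is a `K⁺`-automorphism `τ̃` of
`H = hilbertClassField K` with `τ̃|_K = complexConj K` (`H/K⁺` is Galois; Okazaki: «Let σ be the complex
conjugation of K … σ acts on a field K which contains H»). [cite: Okazaki2000, §5, proof of Prop. 27] -/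
theorem IsCMField.exists_lift_complexConj :
    ∃ τ : hilbertClassField K ≃ₐ[maximalRealSubfield K] hilbertClassField K,
      ∀ x : K, τ (algebraMap K (hilbertClassField K) x) =
        algebraMap K (hilbertClassField K) (complexConj K x) :=
  ⟨AlgEquiv.liftNormal (complexConj K) (hilbertClassField K),
    AlgEquiv.liftNormal_commutes (complexConj K) (hilbertClassField K)⟩

end Setup

/-! ### §2. Norm limitation: the fixed field of `artinEquiv(N_{L/K} Cl_L)` embeds into `L` -/

section NormLimitation

variable (K L : Type) [Field K] [NumberField K] [Field L] [NumberField L] [Algebra K L]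

/-- `galSubgroup` is monotone. [folklore] -/
private theorem galSubgroup_mono {S S' : Subgroup (ClassGroup (𝓞 K))} (h : S ≤ S') :
    galSubgroup K S ≤ galSubgroup K S' :=
  Subgroup.map_mono h

/-- **Norm limitation for the Hilbert class field**: for every subgroup `S ≥ N_{L/K}(Cl_L)` of `Cl(𝓞 K)`,
the fixed field of `artinEquiv(S)` in `H = hilbertClassField K` — the class field of `S` — embeds into
`L` over `K` (it is contained in `L ∩ H`, the fixed field of `artinEquiv(N_{L/K} Cl_L)`, computed inside
the normal closure of `H · L`; tree `range_classGroupNorm_eq`). [cite: Lang1990, Ch. 3 §4, Lemma (proof)]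
[cite: Washington1997, Thm. 10.1 (proof)] -/
theorem nonempty_algHom_fixedField_galSubgroup (S : Subgroup (ClassGroup (𝓞 K)))
    (hS : (classGroupNorm K L).range ≤ S) :
    Nonempty (IntermediateField.fixedField (galSubgroup K S) →ₐ[K] L) := by
  classical
  haveI : Algebra.IsAlgebraic K L := Algebra.IsAlgebraic.of_finite K L
  -- the ambient Galois extension `E ⊆ K̄`: the normal closure of `H · L₀`
  let H : IntermediateField K (AlgebraicClosure K) := hilbertClassField K
  let ι : L →ₐ[K] AlgebraicClosure K := IsAlgClosed.lift
  let L₀ : IntermediateField K (AlgebraicClosure K) := ι.fieldRange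
  let eL : L ≃ₐ[K] L₀ := AlgEquiv.ofInjectiveField ι
  haveI : FiniteDimensional K L₀ := LinearEquiv.finiteDimensional eL.toLinearEquiv
  let C : IntermediateField K (AlgebraicClosure K) := H ⊔ L₀
  haveI : FiniteDimensional K C := IntermediateField.finiteDimensional_sup H L₀
  let E : IntermediateField K (AlgebraicClosure K) :=
    IntermediateField.normalClosure K C (AlgebraicClosure K)
  haveI : NumberField E := NumberField.of_module_finite K E
  have hCE : C ≤ E := IntermediateField.le_normalClosure C
  have hHE : H ≤ E := le_sup_left.trans hCE
  have hLE : L₀ ≤ E := le_sup_right.trans hCE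
  let jH : H →ₐ[K] E := IntermediateField.inclusion hHE
  let jL : L →ₐ[K] E := (IntermediateField.inclusion hLE).comp eL.toAlgHom
  letI : Algebra H E := jH.toRingHom.toAlgebra
  letI : Algebra L E := jL.toRingHom.toAlgebra
  haveI : IsScalarTower K H E := IsScalarTower.of_algebraMap_eq fun x => (jH.commutes x).symm
  haveI : IsScalarTower K L E := IsScalarTower.of_algebraMap_eq fun x => (jL.commutes x).symm
  have hrange := range_classGroupNorm_eq K L E
  have hH : IsScalarTower.toAlgHom K H E = jH := AlgHom.ext fun _ => rfl
  have hL' : IsScalarTower.toAlgHom K L E = jL := AlgHom.ext fun _ => rfl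
  rw [hH, hL'] at hrange
  set F₁ : IntermediateField K H := (jL.fieldRange).comap jH with hF₁
  -- `galSubgroup (N.range) = Gal(H/F₁)`, so `fixedField (galSubgroup S) ≤ F₁`
  have hgal : galSubgroup K (classGroupNorm K L).range = F₁.fixingSubgroup := by
    rw [galSubgroup, hrange, Subgroup.map_comap_eq_self_of_surjective]
    rw [MulEquiv.coe_toMonoidHom]  -- range condition
    exact fun g => ⟨(artinEquiv K).symm g, (artinEquiv K).apply_symm_apply g⟩
  have hle : IntermediateField.fixedField (galSubgroup K S) ≤ F₁ := by
    calc IntermediateField.fixedField (galSubgroup K S)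
        ≤ IntermediateField.fixedField (galSubgroup K (classGroupNorm K L).range) :=
          IntermediateField.fixedField_antitone (galSubgroup_mono K hS)
      _ = F₁ := by rw [hgal, IsGalois.fixedField_fixingSubgroup]
  -- `F₁ → L`: pull back along `jL`
  have hmem : ∀ x : F₁, jH (x : H) ∈ jL.range := fun x => by
    obtain ⟨y, hy⟩ : ∃ y : L, jL y = jH (x : H) := x.2
    exact ⟨y, hy⟩
  let f₀ : F₁ →ₐ[K] jL.range := (jH.comp F₁.val).codRestrict jL.range hmem
  let f : F₁ →ₐ[K] L := (AlgEquiv.ofInjectiveField jL).symm.toAlgHom.comp f₀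
  exact ⟨f.comp (IntermediateField.inclusion hle)⟩

end NormLimitation

/-! ### §3. The class field of a `τ`-stable `S ⊇ N_{L/K}(Cl_L)` is CM, and `τ̃ g τ̃⁻¹ ≡ g` modulo `artinEquiv(S)` -/

section Key

variable (K : Type) [Field K] [NumberField K] [IsCMField K]

attribute [local instance] isScalarTower_hcf isGalois_hcf

/-- `complexConj K` is an involution of `K` (as an element of `Gal(K/K⁺)`). [folklore] -/
private theorem complexConj_mul_self : complexConj K * complexConj K = 1 :=
  AlgEquiv.ext fun x => complexConj_apply_apply K x

/-- Complex conjugation acts as an involution on `Cl(𝓞 K)`. [folklore] -/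
private theorem conj_smul_conj_smul (c : ClassGroup (𝓞 K)) :
    ClassGroup.mulEquiv (AmbiguousClass.intAut (complexConj K))
      (ClassGroup.mulEquiv (AmbiguousClass.intAut (complexConj K)) c) = c := by
  rw [← MulEquiv.trans_apply, ← AmbiguousClass.mulEquiv_intAut_mul, complexConj_mul_self,
    AmbiguousClass.mulEquiv_intAut_one, MulEquiv.refl_apply]

/-- A lift `τ̃` of complex conjugation has `τ̃⁻¹` also lifting complex conjugation. [folklore] -/
private theorem symm_lift {τ : hilbertClassField K ≃ₐ[maximalRealSubfield K] hilbertClassField K}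
    (hτ : ∀ x : K, τ (algebraMap K (hilbertClassField K) x) =
      algebraMap K (hilbertClassField K) (complexConj K x)) (x : K) :
    τ.symm (algebraMap K (hilbertClassField K) x) =
      algebraMap K (hilbertClassField K) (complexConj K x) := by
  apply τ.injective
  rw [AlgEquiv.apply_symm_apply, hτ, complexConj_apply_apply]

/-- **The class field of a conjugation-stable subgroup is conjugation-stable**: if `S ≤ Cl(𝓞 K)` is
stable under complex conjugation then the fixed field `F_S` of `artinEquiv(S)` in `H` is stable under
any lift `τ̃` of complex conjugation and under `τ̃⁻¹` (by the equivariance of `artinEquiv`).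
[cite: Okazaki2000, §5, proof of Prop. 27 («σ preserves C … Gal(H/k) ≃ C_k/C of σ-modules»)] -/
theorem IsCMField.lift_mem_fixedField_galSubgroup
    {τ : hilbertClassField K ≃ₐ[maximalRealSubfield K] hilbertClassField K}
    (hτ : ∀ x : K, τ (algebraMap K (hilbertClassField K) x) =
      algebraMap K (hilbertClassField K) (complexConj K x))
    {S : Subgroup (ClassGroup (𝓞 K))}
    (hSτ : ∀ s ∈ S, ClassGroup.mulEquiv (AmbiguousClass.intAut (complexConj K)) s ∈ S)
    {x : hilbertClassField K} (hx : x ∈ IntermediateField.fixedField (galSubgroup K S)) :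
    τ x ∈ IntermediateField.fixedField (galSubgroup K S) ∧
      τ.symm x ∈ IntermediateField.fixedField (galSubgroup K S) := by
  rw [IntermediateField.mem_fixedField_iff] at hx ⊢
  rw [IntermediateField.mem_fixedField_iff]
  have key : ∀ h ∈ galSubgroup K S, ∃ s ∈ S,
      h = artinEquiv K (ClassGroup.mulEquiv (AmbiguousClass.intAut (complexConj K)) s) := by
    intro h hh
    rw [galSubgroup, Subgroup.mem_map] at hh
    obtain ⟨s, hs, rfl⟩ := hh
    exact ⟨_, hSτ s hs, by rw [MulEquiv.coe_toMonoidHom, conj_smul_conj_smul]⟩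
  have hfix : ∀ s ∈ S, artinEquiv K s x = x := fun s hs =>
    hx _ (by rw [galSubgroup, Subgroup.mem_map]; exact ⟨s, hs, rfl⟩)
  constructor
  · intro h hh
    obtain ⟨s, hs, rfl⟩ := key h hh
    rw [artinEquiv_mulEquiv_intAut_apply K τ (complexConj K) hτ, AlgEquiv.symm_apply_apply,
      hfix s hs]
  · intro h hh
    obtain ⟨s, hs, rfl⟩ := key h hh
    rw [artinEquiv_mulEquiv_intAut_apply K τ.symm (complexConj K) (symm_lift K hτ),
      AlgEquiv.symm_symm, AlgEquiv.apply_symm_apply, hfix s hs]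

/-- For a CM field `F`, complex conjugation commutes with EVERY ring endomorphism of `F` (read both
sides along a complex embedding). [cite: Okazaki2000, §2 Lemma 6] -/
theorem IsCMField.ringHom_complexConj {F : Type*} [Field F] [NumberField F] [IsCMField F]
    (e : F →+* F) (y : F) : e (complexConj F y) = complexConj F (e y) := by
  obtain ⟨φ⟩ : Nonempty (F →+* ℂ) := inferInstance
  apply φ.injective
  rw [complexEmbedding_complexConj, ← RingHom.comp_apply, ← RingHom.comp_apply,
    complexEmbedding_complexConj]
  rfl

variable (L : Type) [Field L] [NumberField L] [IsCMField L] [Algebra K L]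

/-- **The class field of `S ⊇ N_{L/K}(Cl_L)` is a CM field** for CM fields `K ⊆ L`: it embeds into `L`
over `K` (§2), and a subfield of a CM field containing the totally complex `K` is CM (Okazaki's Lemma 12;
tree `isCMField_of_ringHom_of_not_isReal`). [cite: Okazaki2000, §2 Lemma 12 and §5, proof of Prop. 27 («H is a CM-field»)] -/
theorem IsCMField.isCMField_fixedField_galSubgroup (S : Subgroup (ClassGroup (𝓞 K)))
    (hS : (classGroupNorm K L).range ≤ S) :
    IsCMField (IntermediateField.fixedField (galSubgroup K S)) := by
  set F := IntermediateField.fixedField (galSubgroup K S) with hF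
  haveI : NumberField F := NumberField.of_module_finite K F
  obtain ⟨f⟩ := nonempty_algHom_fixedField_galSubgroup K L S hS
  obtain ⟨ψ⟩ : Nonempty (F →+* ℂ) := inferInstance
  refine isCMField_of_ringHom_of_not_isReal f.toRingHom (Or.inr inferInstance) (ψ := ψ) fun hψ => ?_
  exact IsTotallyComplex.complexEmbedding_not_isReal (ψ.comp (algebraMap K F)) (hψ.comp _)

end Key

/-! ### §4. Okazaki's Prop. 27: `τ̃ g τ̃⁻¹ g⁻¹ ∈ artinEquiv(S)`, hence `c̄ · c⁻¹ ∈ S` and `c² ∈ S` -/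

section PropTwentySeven

variable (K L : Type) [Field K] [NumberField K] [IsCMField K] [Field L] [NumberField L]
  [IsCMField L] [Algebra K L]

attribute [local instance] isScalarTower_hcf isGalois_hcf

/-- **The heart of Okazaki's Prop. 27**: let `K ⊆ L` be CM fields, `S ≤ Cl(𝓞 K)` a conjugation-stable
subgroup containing `N_{L/K}(Cl_L)`, `F_S ⊆ H` its class field and `τ̃` a lift of complex conjugation to
`H`.  Then for every `g ∈ Gal(H/K)` the commutator `(τ̃ g τ̃⁻¹) g⁻¹` lies in `artinEquiv(S) = Gal(H/F_S)`:
on the CM field `F_S` (§3) the restriction of `τ̃` is `(complex conjugation of F_S) ∘ ρ` with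
`ρ ∈ Gal(F_S/K)`, complex conjugation of `F_S` commutes with every automorphism (Okazaki's Lemma 6) and
`Gal(F_S/K)` is abelian, so `τ̃ g τ̃⁻¹ = g` on `F_S`.
[cite: Okazaki2000, §5 Prop. 27 (proof: «the action of σ on Gal(H/k) is trivial»)] -/
theorem IsCMField.conj_mul_inv_mem_galSubgroup
    {τ : hilbertClassField K ≃ₐ[maximalRealSubfield K] hilbertClassField K}
    (hτ : ∀ x : K, τ (algebraMap K (hilbertClassField K) x) =
      algebraMap K (hilbertClassField K) (complexConj K x))
    {S : Subgroup (ClassGroup (𝓞 K))} (hS : (classGroupNorm K L).range ≤ S)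
    (hSτ : ∀ s ∈ S, ClassGroup.mulEquiv (AmbiguousClass.intAut (complexConj K)) s ∈ S)
    {g g' : hilbertClassField K ≃ₐ[K] hilbertClassField K} (hg' : ∀ y, g' y = τ (g (τ.symm y))) :
    g' * g⁻¹ ∈ galSubgroup K S := by
  set G := galSubgroup K S with hG
  set F : IntermediateField K (hilbertClassField K) := IntermediateField.fixedField G with hFdef
  haveI : G.Normal := Subgroup.normal_of_isMulCommutative _
  haveI : IsGalois K F := IsGalois.of_fixedField_normal_subgroup G
  haveI : NumberField F := NumberField.of_module_finite K F
  haveI hCM : IsCMField F := IsCMField.isCMField_fixedField_galSubgroup K L S hS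
  rw [show G = F.fixingSubgroup from (IntermediateField.fixingSubgroup_fixedField G).symm,
    IntermediateField.mem_fixingSubgroup_iff]
  intro x hx
  have stab : ∀ y : hilbertClassField K, y ∈ F → τ y ∈ F ∧ τ.symm y ∈ F := fun y hy =>
    IsCMField.lift_mem_fixedField_galSubgroup K hτ hSτ hy
  -- the players on `F`
  let τF : F ≃+* F :=
    { toFun := fun y => ⟨τ y, (stab y y.2).1⟩
      invFun := fun y => ⟨τ.symm y, (stab y y.2).2⟩
      left_inv := fun y => Subtype.ext (τ.symm_apply_apply (y : hilbertClassField K))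
      right_inv := fun y => Subtype.ext (τ.apply_symm_apply (y : hilbertClassField K))
      map_mul' := fun y z => Subtype.ext (map_mul τ _ _)
      map_add' := fun y z => Subtype.ext (map_add τ _ _) }
  have hτF : ∀ y : F, ((τF y : F) : hilbertClassField K) = τ y := fun y => rfl
  have hτFs : ∀ y : F, ((τF.symm y : F) : hilbertClassField K) = τ.symm y := fun y => rfl
  let gF : F ≃ₐ[K] F := g.restrictNormal F
  have hgF : ∀ y : F, ((gF y : F) : hilbertClassField K) = g y := fun y =>
    AlgEquiv.restrictNormal_apply F g y
  -- `ρ = conj_F ∘ τ̃|_F` is `K`-linear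
  have hρK : ∀ k : K, (τF.trans (complexConj F).toRingEquiv) (algebraMap K F k) = algebraMap K F k := by
    intro k
    change complexConj F (τF (algebraMap K F k)) = algebraMap K F k
    have h1 : τF (algebraMap K F k) = algebraMap K F (complexConj K k) := by
      apply Subtype.ext
      rw [hτF]
      exact hτ k
    rw [h1, ← algebraMap_complexConj, complexConj_apply_apply]
  let ρ : F ≃ₐ[K] F := AlgEquiv.ofRingEquiv hρK
  have hρ : ∀ y : F, ρ y = complexConj F (τF y) := fun y => rfl
  have hτρ : ∀ y : F, τF y = complexConj F (ρ y) := fun y => by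
    rw [hρ, complexConj_apply_apply]
  have hτρs : ∀ y : F, τF.symm y = ρ.symm (complexConj F y) := fun y => by
    apply τF.injective
    rw [RingEquiv.apply_symm_apply, hτρ, AlgEquiv.apply_symm_apply, complexConj_apply_apply]
  -- `Gal(F/K)` is abelian: `ρ` commutes with `g|_F`
  have hcomm : ∀ y : F, ρ (gF y) = gF (ρ y) := by
    obtain ⟨ρ', hρ'⟩ := AlgEquiv.restrictNormalHom_surjective (F := K) (K₁ := F)
      (E := hilbertClassField K) ρ
    have hg : AlgEquiv.restrictNormalHom F g = gF := rfl
    intro y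
    have h := congrArg (fun e : F ≃ₐ[K] F => e y)
      (show ρ * gF = gF * ρ by
        rw [← hρ', ← hg, ← map_mul, ← map_mul, (hilbertClassField.commute K ρ' g).eq])
    simpa [AlgEquiv.mul_apply] using h
  -- complex conjugation of the CM field `F` is central
  have hcen : ∀ y : F, complexConj F (gF y) = gF (complexConj F y) := fun y =>
    (IsCMField.ringHom_complexConj (gF : F →+* F) y).symm
  -- the computation, on `F`
  have hgx : g⁻¹ x ∈ F := by
    have h := AlgEquiv.restrictNormal_apply F g⁻¹ ⟨x, hx⟩
    rw [← h]
    exact ((g⁻¹).restrictNormal F ⟨x, hx⟩).2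
  set yF : F := ⟨g⁻¹ x, hgx⟩ with hyF
  have main : τF (gF (τF.symm yF)) = gF yF := by
    rw [hτρ, hcomm, hτρs, AlgEquiv.apply_symm_apply, hcen, complexConj_apply_apply]
  have main' := congrArg (fun z : F => (z : hilbertClassField K)) main
  simp only [hτF, hgF, hτFs] at main'
  rw [AlgEquiv.mul_apply, hg', main']
  change g (g⁻¹ x) = x
  rw [AlgEquiv.aut_inv, AlgEquiv.apply_symm_apply]

end PropTwentySeven

/-! ### §5. Prop. 27: `c² ∈ N_{L/K}(Cl_L) · ι(Cl_{K⁺})` for every class `c` of `K`; Lemma 24 for all CM pairs -/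

section Consequences

variable (K L : Type) [Field K] [NumberField K] [IsCMField K] [Field L] [NumberField L]
  [IsCMField L] [Algebra K L]

attribute [local instance] isScalarTower_hcf isGalois_hcf

/-- **`c̄ · c⁻¹ ∈ S`** for every class `c` of `K` and every conjugation-stable `S ⊇ N_{L/K}(Cl_L)`:
complex conjugation acts trivially on `Cl(𝓞 K)/S ≅ Gal(F_S/K)` (§4 through the equivariant Artin
isomorphism). [cite: Okazaki2000, §5 Prop. 27 (proof)] -/
theorem IsCMField.conj_smul_mul_inv_mem {S : Subgroup (ClassGroup (𝓞 K))}
    (hS : (classGroupNorm K L).range ≤ S)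
    (hSτ : ∀ s ∈ S, ClassGroup.mulEquiv (AmbiguousClass.intAut (complexConj K)) s ∈ S)
    (c : ClassGroup (𝓞 K)) :
    ClassGroup.mulEquiv (AmbiguousClass.intAut (complexConj K)) c * c⁻¹ ∈ S := by
  obtain ⟨τ, hτ⟩ := IsCMField.exists_lift_complexConj K
  obtain ⟨g', hg'⟩ := exists_algEquiv_conj K τ (complexConj K) hτ (artinEquiv K c)
  have h1 : artinEquiv K (ClassGroup.mulEquiv (AmbiguousClass.intAut (complexConj K)) c) = g' :=
    AlgEquiv.ext fun y => by rw [artinEquiv_mulEquiv_intAut_apply K τ (complexConj K) hτ, hg']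
  rw [← artinEquiv_mem_galSubgroup_iff, map_mul, map_inv, h1]
  exact IsCMField.conj_mul_inv_mem_galSubgroup K L hτ hS hSτ hg'

/-- Complex conjugation fixes the classes extended from `K⁺`: `\overline{ι(e)} = ι(e)`. [cite: Okazaki2000, §5, proof of Prop. 27 («It obviously preserves ιC_{k⁺}»)] -/
theorem IsCMField.conj_smul_classGroupExtend (e : ClassGroup (𝓞 (maximalRealSubfield K))) :
    ClassGroup.mulEquiv (AmbiguousClass.intAut (complexConj K))
        (classGroupExtend (maximalRealSubfield K) K e) =
      classGroupExtend (maximalRealSubfield K) K e := by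
  have h := classGroupExtend_mulEquiv_intAut (maximalRealSubfield K) K (complexConj K)
    (1 : maximalRealSubfield K ≃ₐ[maximalRealSubfield K] maximalRealSubfield K)
    (fun x => by rw [AlgEquiv.one_apply]; exact complexConj_apply_eq_self K x) e
  rw [AmbiguousClass.mulEquiv_intAut_one, MulEquiv.refl_apply] at h
  exact h.symm

/-- The subgroup `N_{L/K}(Cl_L) · ι(Cl_{K⁺})` is conjugation-stable. [cite: Okazaki2000, §5, proof of Prop. 27 («Therefore, it preserves C»)] -/
theorem IsCMField.conj_smul_mem_sup {s : ClassGroup (𝓞 K)}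
    (hs : s ∈ (classGroupNorm K L).range ⊔ (classGroupExtend (maximalRealSubfield K) K).range) :
    ClassGroup.mulEquiv (AmbiguousClass.intAut (complexConj K)) s ∈
      (classGroupNorm K L).range ⊔ (classGroupExtend (maximalRealSubfield K) K).range := by
  obtain ⟨y, ⟨d, rfl⟩, z, ⟨e, rfl⟩, rfl⟩ := Subgroup.mem_sup.mp hs
  rw [map_mul, ← IsCMField.classGroupNorm_conj_smul, IsCMField.conj_smul_classGroupExtend]
  exact Subgroup.mem_sup.mpr ⟨_, ⟨_, rfl⟩, _, ⟨e, rfl⟩, rfl⟩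

/-- **Okazaki's Proposition 27: for every pair of CM fields `K ⊆ L`, the cokernel of
`N : C_L/ιC_{L⁺} → C_K/ιC_{K⁺}` has exponent dividing `2`** — every class `c` of `K` has
`c² ∈ N_{L/K}(Cl_L) · ι(Cl_{K⁺})` (`c² = (c c̄)(c̄ c⁻¹)⁻¹`, `c c̄ = ι(N_{K/K⁺} c)`).
[cite: Okazaki2000, §5 Prop. 27] -/
theorem IsCMField.sq_mem_range_sup_range (c : ClassGroup (𝓞 K)) :
    c ^ 2 ∈ (classGroupNorm K L).range ⊔ (classGroupExtend (maximalRealSubfield K) K).range := by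
  have h1 : c * ClassGroup.mulEquiv (AmbiguousClass.intAut (complexConj K)) c ∈
      (classGroupNorm K L).range ⊔ (classGroupExtend (maximalRealSubfield K) K).range :=
    Subgroup.mem_sup_right (IsCMField.mul_conj_smul_mem_range_classGroupExtend K c)
  have h2 := IsCMField.conj_smul_mul_inv_mem K L le_sup_left
    (fun s hs => IsCMField.conj_smul_mem_sup K L hs) c
  have h3 : c ^ 2 = (c * ClassGroup.mulEquiv (AmbiguousClass.intAut (complexConj K)) c) *
      (ClassGroup.mulEquiv (AmbiguousClass.intAut (complexConj K)) c * c⁻¹)⁻¹ := by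
    rw [mul_inv_rev, inv_inv, ← mul_assoc, mul_right_comm c, mul_inv_cancel_right, sq]
  rw [h3]
  exact mul_mem h1 (inv_mem h2)

/-- **Fourth powers of `ker N_{K/K⁺}` are norms from `ker N_{L/L⁺}`** for every pair of CM fields
`K ⊆ L`: if `N_{K/K⁺} c = 1` then `c⁴ = N_{L/K}(a)` with `a = d/d̄ ∈ ker N_{L/L⁺}`, where `c² = N_{L/K}(d)·ι(e)`
(Prop. 27). [cite: Okazaki2000, §4 Lemma 24 and §5 Prop. 27] -/
theorem IsCMField.pow_four_mem_map_ker_classGroupNorm {c : ClassGroup (𝓞 K)}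
    (hc : c ∈ (classGroupNorm (maximalRealSubfield K) K).ker) :
    c ^ 4 ∈ ((classGroupNorm (maximalRealSubfield L) L).ker).map (classGroupNorm K L) := by
  obtain ⟨y, ⟨d, rfl⟩, z, ⟨e, rfl⟩, hde⟩ := Subgroup.mem_sup.mp (IsCMField.sq_mem_range_sup_range K L c)
  refine ⟨d * (ClassGroup.mulEquiv (AmbiguousClass.intAut (complexConj L)) d)⁻¹,
    IsCMField.mul_conj_smul_inv_mem_ker L d, ?_⟩
  have hτc := IsCMField.conj_smul_eq_inv_of_classGroupNorm_eq_one K hc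
  have hNd : classGroupNorm K L d = c ^ 2 * (classGroupExtend (maximalRealSubfield K) K e)⁻¹ :=
    eq_mul_inv_of_mul_eq hde
  rw [map_mul, map_inv, IsCMField.classGroupNorm_conj_smul, hNd, map_mul, map_inv, map_pow, hτc,
    IsCMField.conj_smul_classGroupExtend, mul_inv_rev, inv_inv, inv_pow, inv_inv, mul_assoc,
    inv_mul_cancel_left, ← pow_add]

/-- **Okazaki's Lemma 24 for every pair of CM fields, `4`-torsion form**:
`#ker N_{K/K⁺} ∣ #(ker N_{K/K⁺})[4] · #ker N_{L/L⁺}`, i.e. `h⁻_K ∣ 2^s · h⁻_L` with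
`2^s = #{c ∈ ker N_{K/K⁺} : c⁴ = 1}` (Okazaki: `2^{r₁}`, `r₁` the `2`-rank — here the exponent-`4` part).
[cite: Okazaki2000, §4 Lemma 24] -/
theorem IsCMField.card_ker_dvd_card_fourTorsion_mul_card_ker :
    Nat.card (classGroupNorm (maximalRealSubfield K) K).ker ∣
      Nat.card {c : (classGroupNorm (maximalRealSubfield K) K).ker // (c : ClassGroup (𝓞 K)) ^ 4 = 1} *
        Nat.card (classGroupNorm (maximalRealSubfield L) L).ker := by
  classical
  set AK := (classGroupNorm (maximalRealSubfield K) K).ker with hAK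
  set AL := (classGroupNorm (maximalRealSubfield L) L).ker with hAL
  set f : AK →* ClassGroup (𝓞 K) := (powMonoidHom 4).comp AK.subtype with hf
  have hrange : f.range ≤ AL.map (classGroupNorm K L) := by
    rintro _ ⟨c, rfl⟩
    exact IsCMField.pow_four_mem_map_ker_classGroupNorm K L c.2
  have hker : Nat.card f.ker = Nat.card {c : AK // (c : ClassGroup (𝓞 K)) ^ 4 = 1} :=
    Nat.card_congr (Equiv.subtypeEquivRight fun c => by
      rw [MonoidHom.mem_ker, hf, MonoidHom.comp_apply, powMonoidHom_apply, Subgroup.subtype_apply])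
  have hcard : Nat.card f.ker * Nat.card f.range = Nat.card AK := by
    rw [← Subgroup.index_ker, Subgroup.card_mul_index]
  rw [← hcard, ← hker]
  exact Nat.mul_dvd_mul_left _
    ((Subgroup.card_dvd_of_le hrange).trans (Subgroup.card_map_dvd _ _))

/-- **`h⁻_K` odd ⟹ `h⁻_K ∣ h⁻_L` for EVERY pair of CM fields `K ⊆ L`** (no hypothesis on `L/K`):
Okazaki's Lemma 24 with `r₁ = 0` (and the conclusion of his Cor. 29 without the odd-degree hypothesis,
for odd `h⁻_K`). [cite: Okazaki2000, §4 Lemma 24 and §5 Cor. 29] -/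
theorem IsCMField.card_ker_dvd_card_ker_of_odd' (hodd : Odd (Nat.card (classGroupNorm (maximalRealSubfield K) K).ker)) :
    Nat.card (classGroupNorm (maximalRealSubfield K) K).ker ∣
      Nat.card (classGroupNorm (maximalRealSubfield L) L).ker := by
  set AK := (classGroupNorm (maximalRealSubfield K) K).ker with hAK
  set AL := (classGroupNorm (maximalRealSubfield L) L).ker with hAL
  have hcop : (Nat.card AK).Coprime 4 := by
    have h := (Nat.coprime_two_right.mpr hodd).pow_right 2
    norm_num at h
    exact h
  have hle : AK ≤ AL.map (classGroupNorm K L) := by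
    intro c hc
    set d : AK := (powCoprime hcop).symm ⟨c, hc⟩ with hd
    have hdc : ((d ^ 4 : AK) : ClassGroup (𝓞 K)) = c := by
      rw [← powCoprime_apply hcop d, hd, Equiv.apply_symm_apply]
    rw [← hdc, Subgroup.coe_pow]
    exact IsCMField.pow_four_mem_map_ker_classGroupNorm K L d.2
  exact (Subgroup.card_dvd_of_le hle).trans (Subgroup.card_map_dvd _ _)

/-- The same in class numbers: **for CM fields `K ⊆ L` with `h⁻_K = h_K/h_{K⁺}` odd, `h⁻_K ∣ h⁻_L`.**
[cite: Okazaki2000, §4 Lemma 24 and §5 Cor. 29] -/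
theorem IsCMField.classNumber_div_dvd_classNumber_div_of_odd'
    (hodd : Odd (classNumber K / classNumber (maximalRealSubfield K))) :
    classNumber K / classNumber (maximalRealSubfield K) ∣
      classNumber L / classNumber (maximalRealSubfield L) := by
  rw [IsCMField.classNumber_div_eq_card_ker] at hodd ⊢
  rw [IsCMField.classNumber_div_eq_card_ker]
  exact IsCMField.card_ker_dvd_card_ker_of_odd' K L hodd

/-- **`h⁻_K ∣ 2^s · h⁻_L` in class numbers** (`2^s = #(ker N_{K/K⁺})[4]`), every pair of CM fields.
[cite: Okazaki2000, §4 Lemma 24] -/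
theorem IsCMField.classNumber_div_dvd_card_fourTorsion_mul_classNumber_div :
    classNumber K / classNumber (maximalRealSubfield K) ∣
      Nat.card {c : (classGroupNorm (maximalRealSubfield K) K).ker // (c : ClassGroup (𝓞 K)) ^ 4 = 1} *
        (classNumber L / classNumber (maximalRealSubfield L)) := by
  rw [IsCMField.classNumber_div_eq_card_ker, IsCMField.classNumber_div_eq_card_ker]
  exact IsCMField.card_ker_dvd_card_fourTorsion_mul_card_ker K L

/-- **An imaginary quadratic field `K` of odd class number inside ANY CM field `L`: `h_K ∣ h⁻_L`**
(Okazaki's Cor. 2 setting; e.g. `h(ℚ(√−p)) ∣ h⁻(L)` for every CM field `L ∋ √−p`, `p ≡ 3 (mod 4)`, `p > 3`).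
[cite: Okazaki2000, §4 Lemma 24, §5 Cor. 29 and §1 Cor. 2] -/
theorem IsCMField.classNumber_dvd_classNumber_div_of_finrank_eq_two'
    (hK : Module.finrank ℚ K = 2) (hodd : Odd (classNumber K)) :
    classNumber K ∣ classNumber L / classNumber (maximalRealSubfield L) := by
  have h1 : classNumber (maximalRealSubfield K) = 1 := by
    have hf : Module.finrank ℚ (maximalRealSubfield K) = 1 := by
      have h := Module.finrank_mul_finrank ℚ (maximalRealSubfield K) K
      rw [Algebra.IsQuadraticExtension.finrank_eq_two (maximalRealSubfield K) K, hK] at h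
      omega
    have e : maximalRealSubfield K ≃ₐ[ℚ] ℚ :=
      (Subalgebra.topEquiv.symm.trans (Subalgebra.equivOfEq _ _
        (Subalgebra.bot_eq_top_iff_finrank_eq_one.mpr hf).symm)).trans
        (Algebra.botEquiv ℚ (maximalRealSubfield K))
    unfold classNumber
    rw [Fintype.card_congr (ClassGroup.mulEquiv (RingOfIntegers.mapRingEquiv e.toRingEquiv)).toEquiv]
    exact Rat.classNumber_eq
  have h := IsCMField.classNumber_div_dvd_classNumber_div_of_odd' K L
  rw [IsCMField.classNumber_div_eq_classNumber K h1] at h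
  exact h hodd

end Consequences

end Literature.NumberTheory.NumberFields

end
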